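import Literature.Geometry.Kaehler.ComplexTorusAlbertTypeIVFieldLefschetzGroupLinearFactors
import HarnessLib

/-!
# A polarised abelian variety whose endomorphism algebra is a FIELD `K`: `K` is totally real or CM, and
# accordingly `Lf(X)(ℂ) = S(X)(ℂ) ≃* ∏_{σ : K → ℂ} Sp_{2g/e}(ℂ)` («I ∣ Sp_{2g/f} … `f` copies») or
# `≃* ∏_{w : InfinitePlace K} GL_{g/e₀}(ℂ)` («IV ∣ GL_{g/f} … `f` copies»); and for any Rosati-STABLE field
# `f(K) ⊆ End⁰(X)` the Hodge group is block-diagonal in the corresponding eigenframe — NO simplicity hypothesis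

Layer `Literature/Geometry/Kaehler`, namespace `Literature.Geometry.Kaehler.ComplexTorus`; lane `lit-hodgefound`
(Track 2 foundations library), Layer A4 (Lefschetz groups), prover seat `lit-hodgefound-p17` (generation 61),
self-proposed row g61-#6 — the SIMPLICITY-FREE dichotomies assembling the generation-61 engines: g61-#2
`ComplexTorusAlbertTypeILefschetzGroupSymplecticFactors` (`IsRiemannForm.nonempty_lefschetzGroupC_mulEquiv_pi_symplecticGroupC_of_isTotallyReal`,
`…exists_frame_lefschetzGroupC_eq_conj_pi_symplecticGroupC_of_isTotallyReal`, `…exists_frame_hodgeGroupC_le_conj_pi_symplecticGroupC`)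
and g61-#4 `ComplexTorusAlbertTypeIVFieldLefschetzGroupLinearFactors` (`…_of_isCMField`, `…exists_frame_hodgeGroupC_le_conj_pi_siegelLevi`),
dispatched on the tree's `isTotallyReal_or_isCMField_of_rosati_stable`, `forall_rosati_algHom_eq_iff_isTotallyReal`,
`exists_rosati_eq_of_range_eq_endAlgRat` (`ComplexTorusRosatiCM`: Lange Lemma 2.6.4 ∕ 2.6.6, Deligne I Prop. 5.1, Shimura
§5.1 Lemma 2).  The simple-torus versions through the centre are g61-#5 `ComplexTorusSimpleCenterEigenframeHodgeGroupBound`.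
THEOREMS ONLY (no definition, no instance, no notation, no named fact; D-0026, net debt 0).

## Sources, verbatim

* J. S. Milne, *Lefschetz classes on abelian varieties*, Duke Math. J. **96** (1999) 639–675 (held
  `paper:doi-10-1215-s0012-7094-99-09620-5`), §2 p. 648 (PDF p0010 L30–L36): «Let `A` be an abelian variety over `k`, and
  let `E` be a `ℚ`-subalgebra of `End⁰(A)` […] stable under some Rosati involution […] `E = E₁ × ⋯ × E_t`, each `E_i`
  either a totally real field `F` or a CM field `K`»; «Simple abelian variety of type I» (`E = F`: `S(A)_{k^al} ≅ ∏_σ Sp(φ_σ)`),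
  «… of type IV» with `E = K` (`S_σ ≈ GL_{g/(fd)}`, `d = 1`), Remark 2.2; Summary p. 652 («I ∣ Sp_{2g/f} ∣ Yes ∣ Yes»,
  «IV ∣ GL_{g/(df)} ∣ No ∣ Yes», «`f` copies»); §4 p. 660 («`L(A) ⊃ Hg(A)`»).
* P. Deligne, *Hodge cycles on abelian varieties* (LNM 900, 1982), I Prop. 5.1 and its proof («`F` is totally real […]
  `*` is complex conjugation»), §5 («`Hg(A) ⊂ U_E(V, φ)`»).
* H. Lange, *Abelian Varieties over the Complex Numbers* (2023), §2.6.1 (commutative `End_ℚ(X)`: «totally real number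
  field» or «CM field», table lines 1 and 4), Lemma 2.6.4, Lemma 2.6.6, Thm. 2.6.5, §7.2.4 Exercise (4).
* G. Shimura, *Abelian Varieties with Complex Multiplication and Modular Functions* (1998), §5.1 Lemma 2 (p. 36).
* B. Moonen, Yu. Zarhin, Math. Ann. **315** (1999), (2.2)–(2.3) («`Hg(X) ⊆ Res Sp_F(V,ψ)`», «`Hg(X) ⊆ U_F(V,ψ)`»).

## What is proved (CONCRETE torus level `X = E/Φ(ℤ^ι)` polarised by `η` with rational Gram matrix `G`)

* §1 `IsRiemannForm.isTotallyReal_or_isCMField_of_rosati_stable`, **`IsRiemannForm.isTotallyReal_or_isCMField_of_range_eq_endAlgRat`**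
  (`End⁰(X) = f(K)` a field ⟹ `K` totally real or CM — polarised front-ends of `ComplexTorusRosatiCM`).
* §2 `End⁰(X) = f(K)` A FIELD — THE «GROUP» COLUMN, BOTH CASES AT ONCE:
  **`IsRiemannForm.lefschetzGroupC_mulEquiv_dichotomy_of_range_eq_endAlgRat`** (`K` totally real ∧
  `S(X)(ℂ) ≃* ∏_{σ : K → ℂ} Sp_{2n}(ℂ)`, `n · e = g`, OR `K` CM ∧ `S(X)(ℂ) ≃* ∏_{w} GL_n(ℂ)`, `n · e₀ = g`, `2e₀ = e`),
  `IsRiemannForm.lefschetzIdentityC_mulEquiv_dichotomy_of_range_eq_endAlgRat` (Lange's `Lf`, `= S` in both cases),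
  **`IsRiemannForm.exists_frame_lefschetzGroupC_eq_dichotomy_of_range_eq_endAlgRat`** (the subgroup identities in a Darboux ∕
  unitary eigenframe).
* §3 A ROSATI-STABLE FIELD `f(K) ⊆ End⁰(X)` — THE HODGE BOUND, BOTH CASES:
  `IsRiemannForm.exists_frame_hodgeGroupC_le_conj_pi_symplecticGroupC_of_rosati_stable` (`K` totally real: stable ⟹ fixed),
  **`IsRiemannForm.hodgeGroupC_le_eigenframe_dichotomy_of_rosati_stable`** (`K` totally real ∧
  `Hg(X)(ℂ) ⊆ P · e⁻¹(∏_σ Sp_{2n}(ℂ)) · P⁻¹`, OR `K` CM ∧ `Hg(X)(ℂ) ⊆ P · e⁻¹(∏_w {diag(g, ᵗg⁻¹)}) · P⁻¹`).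

NOT here: non-commutative Rosati-stable subalgebras `E = E₁ × ⋯ × E_t` (products of fields: blockwise, via the tree's
isogeny-factor files), types II∕III.
-/

open Module Matrix NumberField

namespace Literature.Geometry.Kaehler

namespace ComplexTorus

section Polarised

variable {ι : Type*} [Fintype ι] [DecidableEq ι] [Nonempty ι] {E : Type*} [NormedAddCommGroup E] [NormedSpace ℂ E]
  {Φ : (ι → ℝ) ≃L[ℝ] E} {η : E [⋀^Fin 2]→L[ℝ] ℝ} {G : Matrix ι ι ℚ} {K : Type*} [Field K] [NumberField K]

/-! ## §1 A Rosati-stable field of endomorphisms of a polarised torus is totally real or CM -/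

/-- **A Rosati-STABLE number field `f(K) ⊆ End⁰(X)` of a polarised complex torus is totally real or a CM field** («each `E_i`
either a totally real field `F` or a CM field `K`»; the polarised front-end of the tree's `isTotallyReal_or_isCMField_of_rosati_stable`).
[cite: Milne1999LefschetzClasses, §2 p. 648 («stable under some Rosati involution … each `E_i` is either a totally real field or a CM field»)]
[cite: Lange2023AbelianVarietiesComplex, Lemma 2.6.4 and Lemma 2.6.6] [cite: Shimura1998, §5.1 Lemma 2 (p. 36)] -/
theorem IsRiemannForm.isTotallyReal_or_isCMField_of_rosati_stable (hη : IsRiemannForm Φ η)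
    (hG : G.map (Rat.cast : ℚ → ℝ) = latticeGram Φ η) (f : K →ₐ[ℚ] Matrix ι ι ℚ) (hf : ∀ a, f a ∈ endAlgRat Φ)
    (hst : ∀ a, ∃ b, rosati G (f a) = f b) : IsTotallyReal K ∨ IsCMField K :=
  ComplexTorus.isTotallyReal_or_isCMField_of_rosati_stable Φ hη.1 hη.2.2 hG f hf hst

/-- **A polarised abelian variety whose endomorphism algebra IS a field `K`: `K` is totally real or CM** (`End⁰(X)` is
stable under its own Rosati involution — Lange Lemma 2.4.1 —; commutative `End_ℚ(X)`: lines «totally real number field»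
and «CM field» of Lange's table). [cite: Lange2023AbelianVarietiesComplex, §2.6.1 Proposition (table, `d = 1`) with Lemma 2.4.1, Lemma 2.6.4, Lemma 2.6.6]
[cite: Deligne1982HodgeCycles, I Prop. 5.1 (proof)] [cite: Milne1999LefschetzClasses, §2 p. 648] -/
theorem IsRiemannForm.isTotallyReal_or_isCMField_of_range_eq_endAlgRat (hη : IsRiemannForm Φ η)
    (f : K →ₐ[ℚ] Matrix ι ι ℚ) (hfE : f.range = endAlgRat Φ) : IsTotallyReal K ∨ IsCMField K := by
  obtain ⟨G, hG⟩ := hη.exists_ratMatrix_latticeGram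
  exact ComplexTorus.isTotallyReal_or_isCMField_of_rosati_stable Φ hη.1 hη.2.2 hG f
    (fun x ↦ hfE ▸ AlgHom.mem_range_self f x) (exists_rosati_eq_of_range_eq_endAlgRat Φ hη.1 hη.2.2 hG f hfE)

/-! ## §2 `End⁰(X) = K` a field: `S(X)(ℂ)` is `f` copies of `Sp_{2g/f}(ℂ)` (`K` totally real) or of `GL_{g/f}(ℂ)` (`K` CM) -/

variable [FiniteDimensional ℂ E]

/-- **THE «GROUP» COLUMN FOR A POLARISED ABELIAN VARIETY WHOSE ENDOMORPHISM ALGEBRA IS A FIELD `K = f(K) = End⁰(X)`: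
EITHER `K` is totally real and `S(X)(ℂ) ≃* ∏_{σ : K → ℂ} Sp_{2n}(ℂ)` with `n · [K:ℚ] = g`, `#{σ} = [K:ℚ]` («I ∣ Sp_{2g/f} … `f`
copies»), OR `K` is a CM field and `S(X)(ℂ) ≃* ∏_{w : InfinitePlace K} GL_n(ℂ)` with `n · #w = g`, `2 · #w = [K:ℚ]`
(«IV ∣ GL_{g/f} … `f` copies», `d = 1`).** [cite: Milne1999LefschetzClasses, §2 «Simple abelian variety of type I» (p. 648–649), «… of type IV» (p. 651), Remark 2.2 and Summary (p. 652)]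
[cite: Lange2023AbelianVarietiesComplex, §2.6.1 Proposition (table, `d = 1`), Thm. 2.6.5] [cite: Deligne1982HodgeCycles, I Prop. 5.1] -/
theorem IsRiemannForm.lefschetzGroupC_mulEquiv_dichotomy_of_range_eq_endAlgRat (hη : IsRiemannForm Φ η)
    (hG : G.map (Rat.cast : ℚ → ℝ) = latticeGram Φ η) (f : K →ₐ[ℚ] Matrix ι ι ℚ) (hfE : f.range = endAlgRat Φ) :
    (IsTotallyReal K ∧ ∃ n : ℕ, n * finrank ℚ K = finrank ℂ E ∧ Fintype.card (K →+* ℂ) = finrank ℚ K ∧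
      Nonempty (lefschetzGroupC Φ G ≃* ((K →+* ℂ) → symplecticGroupC (Fin n)))) ∨
    (IsCMField K ∧ ∃ n : ℕ, n * Fintype.card (InfinitePlace K) = finrank ℂ E ∧
      2 * Fintype.card (InfinitePlace K) = finrank ℚ K ∧
      Nonempty (lefschetzGroupC Φ G ≃* (InfinitePlace K → GL (Fin n) ℂ))) := by
  rcases hη.isTotallyReal_or_isCMField_of_range_eq_endAlgRat f hfE with h | h
  · haveI := h
    exact Or.inl ⟨h, hη.nonempty_lefschetzGroupC_mulEquiv_pi_symplecticGroupC_of_isTotallyReal hG f hfE⟩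
  · haveI := h
    exact Or.inr ⟨h, hη.nonempty_lefschetzGroupC_mulEquiv_pi_generalLinearGroup_of_isCMField hG f hfE⟩

/-- **LANGE'S `Lf(X)` FOR `End⁰(X) = K` A FIELD: `Lf(X)(ℂ) ≃* ∏_{σ} Sp_{2n}(ℂ)` (`K` totally real) OR `≃* ∏_{w} GL_n(ℂ)` (`K` CM)**
(«Connected: Yes» in both rows, `Lf = S`). [cite: Milne1999LefschetzClasses, §2 Summary (p. 652: rows I and IV, «Connected: Yes»)]
[cite: Lange2023AbelianVarietiesComplex, §7.2.4 Exercise (4), Thm. 2.6.5] -/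
theorem IsRiemannForm.lefschetzIdentityC_mulEquiv_dichotomy_of_range_eq_endAlgRat (hη : IsRiemannForm Φ η)
    (hG : G.map (Rat.cast : ℚ → ℝ) = latticeGram Φ η) (f : K →ₐ[ℚ] Matrix ι ι ℚ) (hfE : f.range = endAlgRat Φ) :
    (IsTotallyReal K ∧ ∃ n : ℕ, n * finrank ℚ K = finrank ℂ E ∧ Fintype.card (K →+* ℂ) = finrank ℚ K ∧
      Nonempty (lefschetzIdentityC Φ G ≃* ((K →+* ℂ) → symplecticGroupC (Fin n)))) ∨
    (IsCMField K ∧ ∃ n : ℕ, n * Fintype.card (InfinitePlace K) = finrank ℂ E ∧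
      2 * Fintype.card (InfinitePlace K) = finrank ℚ K ∧
      Nonempty (lefschetzIdentityC Φ G ≃* (InfinitePlace K → GL (Fin n) ℂ))) := by
  rcases hη.isTotallyReal_or_isCMField_of_range_eq_endAlgRat f hfE with h | h
  · haveI := h
    exact Or.inl ⟨h, hη.nonempty_lefschetzIdentityC_mulEquiv_pi_symplecticGroupC_of_isTotallyReal hG f hfE⟩
  · haveI := h
    exact Or.inr ⟨h, hη.nonempty_lefschetzIdentityC_mulEquiv_pi_generalLinearGroup_of_isCMField hG f hfE⟩

/-- **THE SUBGROUP IDENTITIES, BOTH CASES: for `End⁰(X) = f(K)` a field, EITHER `K` is totally real and in a Darboux eigenframe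
`(n, e : ι ≃ Σ_{σ : K → ℂ} (Fin n ⊕ Fin n), P)` with `n · [K:ℚ] = g`, `ᵗP G_ℂ P = e⁻¹(diag_σ J_{2n})`,
`Lf(X)(ℂ) = S(X)(ℂ) = P · e⁻¹(∏_σ Sp_{2n}(ℂ)) · P⁻¹`, OR `K` is CM and in a unitary eigenframe
`(n, e : ι ≃ Σ_{w} (Fin n ⊕ Fin n), P)` with `n · #w = g`, `2 · #w = [K:ℚ]`, `ᵗP G_ℂ P = e⁻¹(diag_w J_{2n})`,
`Lf(X)(ℂ) = S(X)(ℂ) = P · e⁻¹(∏_w {diag(g, ᵗg⁻¹)}) · P⁻¹`.** [cite: Milne1999LefschetzClasses, §2 (p. 648–651: «`(V(A), φ) ⊗ k^al = ⊕_σ (V_σ, φ_σ)` … `S(A)_{k^al} ≅ ∏_σ S_σ`»), Remark 2.2]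
[cite: Lange2023AbelianVarietiesComplex, Thm. 2.6.5 and §7.2.4 Exercise (4)] [cite: Deligne1982HodgeCycles, I Prop. 5.1] -/
theorem IsRiemannForm.exists_frame_lefschetzGroupC_eq_dichotomy_of_range_eq_endAlgRat [DecidableEq (K →+* ℂ)]
    [DecidableEq (InfinitePlace K)] (hη : IsRiemannForm Φ η) (hG : G.map (Rat.cast : ℚ → ℝ) = latticeGram Φ η)
    (f : K →ₐ[ℚ] Matrix ι ι ℚ) (hfE : f.range = endAlgRat Φ) :
    (IsTotallyReal K ∧
      ∃ (n : ℕ) (e : ι ≃ Σ _ : (K →+* ℂ), Fin n ⊕ Fin n) (P : Matrix ι ι ℂ) (hP : IsUnit P.det),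
        n * finrank ℚ K = finrank ℂ E ∧
        (∀ j : ι, (fun i ↦ P i j) ∈
          ⨅ a : K, Module.End.eigenspace (Matrix.toLin' ((f a).map (algebraMap ℚ ℂ))) ((e j).1 a)) ∧
        Pᵀ * G.map (algebraMap ℚ ℂ) * P =
          (Matrix.blockDiagonal' fun _ : K →+* ℂ ↦ Matrix.J (Fin n) ℂ).submatrix e e ∧
        lefschetzGroupC Φ G = (((Subgroup.pi Set.univ fun _ : K →+* ℂ ↦ symplecticGroupC (Fin n)).map
          (sigmaBlockDiagSL (fun _ : K →+* ℂ ↦ Fin n ⊕ Fin n) ℂ)).map (reindexSLC e).symm.toMonoidHom).map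
          (conjGLC P hP).toMonoidHom ∧
        lefschetzIdentityC Φ G = (((Subgroup.pi Set.univ fun _ : K →+* ℂ ↦ symplecticGroupC (Fin n)).map
          (sigmaBlockDiagSL (fun _ : K →+* ℂ ↦ Fin n ⊕ Fin n) ℂ)).map (reindexSLC e).symm.toMonoidHom).map
          (conjGLC P hP).toMonoidHom) ∨
    (IsCMField K ∧
      ∃ (n : ℕ) (e : ι ≃ Σ _ : InfinitePlace K, Fin n ⊕ Fin n) (P : Matrix ι ι ℂ) (hP : IsUnit P.det),
        n * Fintype.card (InfinitePlace K) = finrank ℂ E ∧ 2 * Fintype.card (InfinitePlace K) = finrank ℚ K ∧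
        (∀ (w : InfinitePlace K) (i : Fin n), (fun k ↦ P k (e.symm ⟨w, Sum.inl i⟩)) ∈
          ⨅ a : K, Module.End.eigenspace (Matrix.toLin' ((f a).map (algebraMap ℚ ℂ))) (w.embedding a)) ∧
        (∀ (w : InfinitePlace K) (i : Fin n), (fun k ↦ P k (e.symm ⟨w, Sum.inr i⟩)) ∈
          ⨅ a : K, Module.End.eigenspace (Matrix.toLin' ((f a).map (algebraMap ℚ ℂ)))
            (ComplexEmbedding.conjugate w.embedding a)) ∧
        Pᵀ * G.map (algebraMap ℚ ℂ) * P =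
          (Matrix.blockDiagonal' fun _ : InfinitePlace K ↦ Matrix.J (Fin n) ℂ).submatrix e e ∧
        lefschetzGroupC Φ G = (((Subgroup.pi Set.univ fun _ : InfinitePlace K ↦ siegelLevi (Fin n)).map
          (sigmaBlockDiagSL (fun _ : InfinitePlace K ↦ Fin n ⊕ Fin n) ℂ)).map (reindexSLC e).symm.toMonoidHom).map
          (conjGLC P hP).toMonoidHom ∧
        lefschetzIdentityC Φ G = (((Subgroup.pi Set.univ fun _ : InfinitePlace K ↦ siegelLevi (Fin n)).map
          (sigmaBlockDiagSL (fun _ : InfinitePlace K ↦ Fin n ⊕ Fin n) ℂ)).map (reindexSLC e).symm.toMonoidHom).map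
          (conjGLC P hP).toMonoidHom) := by
  rcases hη.isTotallyReal_or_isCMField_of_range_eq_endAlgRat f hfE with h | h
  · haveI := h
    exact Or.inl ⟨h, hη.exists_frame_lefschetzGroupC_eq_conj_pi_symplecticGroupC_of_isTotallyReal hG f hfE⟩
  · haveI := h
    exact Or.inr ⟨h, hη.exists_frame_lefschetzGroupC_eq_conj_pi_siegelLevi_of_isCMField hG f hfE⟩

end Polarised

/-! ## §3 A Rosati-stable field `f(K) ⊆ End⁰(X)`: the Hodge group in the `K`-eigenframe, both cases -/

section Hodge

variable {ι : Type*} [Fintype ι] [DecidableEq ι] [Nonempty ι] {E : Type*} [NormedAddCommGroup E] [NormedSpace ℂ E]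
  {Φ : (ι → ℝ) ≃L[ℝ] E} {η : E [⋀^Fin 2]→L[ℝ] ℝ} {G : Matrix ι ι ℚ} {K : Type*} [Field K] [NumberField K]

/-- **A Rosati-STABLE totally real `f(K) ⊆ End⁰(X)` is Rosati-FIXED, so `Hg(X)(ℂ) ⊆ S(X)(ℂ) ⊆ P · e⁻¹(∏_{σ : K → ℂ} Sp_{2n}(ℂ)) · P⁻¹`
in a Darboux eigenframe with `2n · [K:ℚ] = 2g`** (first kind: `′ = id` on a stable totally real field, Lemma 2.6.4; then g61-#2
§2). [cite: Lange2023AbelianVarietiesComplex, Lemma 2.6.4] [cite: MoonenZarhin1999LowDim, (2.2)–(2.3) («`Hg(X) ⊆ Res Sp_F(V,ψ)`»)]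
[cite: Milne1999LefschetzClasses, §4 (p. 660: «`L(A) ⊃ Hg(A)`») and §2 «Simple abelian variety of type I»] -/
theorem IsRiemannForm.exists_frame_hodgeGroupC_le_conj_pi_symplecticGroupC_of_rosati_stable [IsTotallyReal K]
    [DecidableEq (K →+* ℂ)] (hη : IsRiemannForm Φ η) (hG : G.map (Rat.cast : ℚ → ℝ) = latticeGram Φ η)
    (f : K →ₐ[ℚ] Matrix ι ι ℚ) (hf : ∀ a, f a ∈ endAlgRat Φ) (hst : ∀ a, ∃ b, rosati G (f a) = f b) :
    ∃ (n : ℕ) (e : ι ≃ Σ _ : (K →+* ℂ), Fin n ⊕ Fin n) (P : Matrix ι ι ℂ) (hP : IsUnit P.det),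
      2 * n * finrank ℚ K = Fintype.card ι ∧
      (∀ j : ι, (fun i ↦ P i j) ∈
        ⨅ a : K, Module.End.eigenspace (Matrix.toLin' ((f a).map (algebraMap ℚ ℂ))) ((e j).1 a)) ∧
      Pᵀ * G.map (algebraMap ℚ ℂ) * P = (Matrix.blockDiagonal' fun _ : K →+* ℂ ↦ Matrix.J (Fin n) ℂ).submatrix e e ∧
      lefschetzGroupC Φ G ≤ (((Subgroup.pi Set.univ fun _ : K →+* ℂ ↦ symplecticGroupC (Fin n)).map
        (sigmaBlockDiagSL (fun _ : K →+* ℂ ↦ Fin n ⊕ Fin n) ℂ)).map (reindexSLC e).symm.toMonoidHom).map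
        (conjGLC P hP).toMonoidHom ∧
      hodgeGroupC Φ ≤ (((Subgroup.pi Set.univ fun _ : K →+* ℂ ↦ symplecticGroupC (Fin n)).map
        (sigmaBlockDiagSL (fun _ : K →+* ℂ ↦ Fin n ⊕ Fin n) ℂ)).map (reindexSLC e).symm.toMonoidHom).map
        (conjGLC P hP).toMonoidHom :=
  hη.exists_frame_hodgeGroupC_le_conj_pi_symplecticGroupC hG f hf
    ((forall_rosati_algHom_eq_iff_isTotallyReal Φ hη.1 hη.2.2 hG f hf hst).2 ‹_›)

/-- **THE HODGE BOUND FOR A ROSATI-STABLE FIELD `f(K) ⊆ End⁰(X)`, BOTH CASES: EITHER `K` is totally real and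
`Hg(X)(ℂ) ⊆ P · e⁻¹(∏_{σ : K → ℂ} Sp_{2n}(ℂ)) · P⁻¹` (`2n · [K:ℚ] = 2g`) in a Darboux eigenframe of `V_ℂ = ⊕_σ V_σ`, OR `K` is CM and
`Hg(X)(ℂ) ⊆ P · e⁻¹(∏_{w} {diag(g, ᵗg⁻¹)}) · P⁻¹` (`n · [K:ℚ] = 2g`) in a unitary eigenframe of `V_ℂ = ⊕_w (V_{σ_w} ⊕ V_{σ̄_w})`**
— «each `E_i` is either a totally real field or a CM field» and «`L(A) ⊃ Hg(A)`» for `E = f(K)`, with no simplicity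
hypothesis. [cite: Milne1999LefschetzClasses, §2 p. 648 and §4 p. 660] [cite: Deligne1982HodgeCycles, §5 («`Hg(A) ⊂ U_E(V, φ)`») and I Prop. 5.1 (proof)]
[cite: MoonenZarhin1999LowDim, (2.2)–(2.3)] [cite: Lange2023AbelianVarietiesComplex, Lemma 2.6.4 and Lemma 2.6.6] -/
theorem IsRiemannForm.hodgeGroupC_le_eigenframe_dichotomy_of_rosati_stable [DecidableEq (K →+* ℂ)]
    [DecidableEq (InfinitePlace K)] (hη : IsRiemannForm Φ η) (hG : G.map (Rat.cast : ℚ → ℝ) = latticeGram Φ η)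
    (f : K →ₐ[ℚ] Matrix ι ι ℚ) (hf : ∀ a, f a ∈ endAlgRat Φ) (hst : ∀ a, ∃ b, rosati G (f a) = f b) :
    (IsTotallyReal K ∧
      ∃ (n : ℕ) (e : ι ≃ Σ _ : (K →+* ℂ), Fin n ⊕ Fin n) (P : Matrix ι ι ℂ) (hP : IsUnit P.det),
        2 * n * finrank ℚ K = Fintype.card ι ∧
        (∀ j : ι, (fun i ↦ P i j) ∈
          ⨅ a : K, Module.End.eigenspace (Matrix.toLin' ((f a).map (algebraMap ℚ ℂ))) ((e j).1 a)) ∧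
        Pᵀ * G.map (algebraMap ℚ ℂ) * P =
          (Matrix.blockDiagonal' fun _ : K →+* ℂ ↦ Matrix.J (Fin n) ℂ).submatrix e e ∧
        hodgeGroupC Φ ≤ (((Subgroup.pi Set.univ fun _ : K →+* ℂ ↦ symplecticGroupC (Fin n)).map
          (sigmaBlockDiagSL (fun _ : K →+* ℂ ↦ Fin n ⊕ Fin n) ℂ)).map (reindexSLC e).symm.toMonoidHom).map
          (conjGLC P hP).toMonoidHom) ∨
    (IsCMField K ∧
      ∃ (n : ℕ) (e : ι ≃ Σ _ : InfinitePlace K, Fin n ⊕ Fin n) (P : Matrix ι ι ℂ) (hP : IsUnit P.det),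
        n * finrank ℚ K = Fintype.card ι ∧
        (∀ (w : InfinitePlace K) (i : Fin n), (fun k ↦ P k (e.symm ⟨w, Sum.inl i⟩)) ∈
          ⨅ a : K, Module.End.eigenspace (Matrix.toLin' ((f a).map (algebraMap ℚ ℂ))) (w.embedding a)) ∧
        (∀ (w : InfinitePlace K) (i : Fin n), (fun k ↦ P k (e.symm ⟨w, Sum.inr i⟩)) ∈
          ⨅ a : K, Module.End.eigenspace (Matrix.toLin' ((f a).map (algebraMap ℚ ℂ)))
            (ComplexEmbedding.conjugate w.embedding a)) ∧
        Pᵀ * G.map (algebraMap ℚ ℂ) * P =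
          (Matrix.blockDiagonal' fun _ : InfinitePlace K ↦ Matrix.J (Fin n) ℂ).submatrix e e ∧
        hodgeGroupC Φ ≤ (((Subgroup.pi Set.univ fun _ : InfinitePlace K ↦ siegelLevi (Fin n)).map
          (sigmaBlockDiagSL (fun _ : InfinitePlace K ↦ Fin n ⊕ Fin n) ℂ)).map (reindexSLC e).symm.toMonoidHom).map
          (conjGLC P hP).toMonoidHom) := by
  rcases hη.isTotallyReal_or_isCMField_of_rosati_stable hG f hf hst with h | h
  · haveI := h
    obtain ⟨n, e, P, hP, hcard, hcol, hH, -, hHg⟩ :=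
      hη.exists_frame_hodgeGroupC_le_conj_pi_symplecticGroupC_of_rosati_stable hG f hf hst
    exact Or.inl ⟨h, n, e, P, hP, hcard, hcol, hH, hHg⟩
  · haveI := h
    obtain ⟨n, e, P, hP, hcard, hinl, hinr, hH, -, hHg⟩ :=
      hη.exists_frame_hodgeGroupC_le_conj_pi_siegelLevi hG f hf hst
    exact Or.inr ⟨h, n, e, P, hP, hcard, hinl, hinr, hH, hHg⟩

end Hodge

end ComplexTorus

end Literature.Geometry.Kaehler
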